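import Summits.QuantumFields.BalabanUV.Beta.D1BFx.GhostLegFree

/-!
# `BalabanUV.Beta.D1BFx.GhostLegBlockMass` — road «BF-x» for binder row D1, slot (K), END row `hGrp gN` (NEEDLES ∪ G_R): **M10**, THE BLOCK-ROW
# |·|-MASS OF THE SCALAR GHOST LEG WITH n-FREE CONSTANTS, `Σ_{t ∈ B(β)} |Ggh n a y t| ≤ cNear(a)·e^{−ghDelta(a)·dist(blk y, β)}` — a [folklore]
# COROLLARY of the HYPOTHESIS-FREE tree theorem `GhostLegFree.ghost_d0` (leaf-07-g3, p214847); an3-g57's kernel-checked scratch, COURIERED VERBATIM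
# (owner ruling ρ-g9-30 «COURIER ORDER … first refusal gan24-leaf-05-g41 … keep an3's constant body verbatim, cite p214847 BY NAME, no `def … : Prop`»)

HONEST DEPENDENCY (cell records, verbatim): «continuum YM on T⁴ ⇐ BetaPertH ∧ nine spine estimates (0/9 proved); BetaPertH ⇐ (D1) ∧ (D4) ∧
CAP+tail; G-an2-4 gates asym, D1 and NE2/3/4.»  HONEST FRAMING (cell contract, verbatim): «discharging `BetaPertH` makes Bałaban's UV stability
UNCONDITIONAL — a real constructive-QFT result; it is NOT the continuum limit and NOT the Clay problem.»  THIS MODULE DISCHARGES NOTHING of the wall: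
it is a [folklore] block summation of the pointwise Coulomb-core envelope `GhostLegFree.ghost_d0` (`|n²·Ggh n a (b+v) b| ≤ ghA0 a·e^{−(ghDelta a∕n)|v|_∞}∕|v|_∞²`,
near AND far field, EVERY `n ≥ 1`, proved outright in the tree) + the diagonal term `GhostLeg.abs_Ggh_le` + the block geometry `B6QGQDecay237.dist_blk_ge` ∕
`card_B`, `GhostLegFree.natAbs_sub_le_blk` + the cube sum `PoissonInterior.sum_cube_inv_nrm_pow_le` (`Σ_{|z|_∞ ≤ R} nrm z⁻² ≤ 1 + 216R²` at `d = 4`).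
ONE definition with body (the n-free constant `cNear`), no `def … : Prop`, nothing cited as hypothesis, 0 sorry.  Asserts nothing of Bałaban's beyond
what `ghost_d0` already proves.  Root-level binders hW ∕ hR-sockets ∕ hSX-socket ∕ D1Tel ∕ D1Rep — 0 discharged; (K) NOT closed; NOT D1, NOT `BetaPertH`,
NOT continuum, NOT Clay.

ABSOLUTE RULE (cell charter, verbatim): «No internally-minted statement may enter as a cited fact. Every hypothesis is either kernel-proved in this
package or a verbatim quotation of a PUBLISHED theorem with page reference. The manuscript(s) under audit are NOT citable for their own disputed
steps — they are the thing under adjudication; programme-internal (2001/route/tribunal) claims are never citable.»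

WHY (owner d1-p2-g9 ruling ρ-g9-28 (f) «M10 (near-field block-row |·|-mass of the scalar ghost leg, n-free) IS THE LOCATED MISSING LETTER OF ROW (N)»;
an3-g57 RESULT [AN3-G57-M10] journal l.29405, memo `HOME/b2b-balaban-beta-an3/gen57/M10-PRINT.v1.md` 8f15a574020c5422, scratch
`HOME/b2b-balaban-beta-an3/gen57/M10BlockMass.scratch.lean` 72db75220fd296ec (rc 0): «M10 is NOT a letter to display; it is a [folklore] COROLLARY of
`GhostLegFree.ghost_d0`»; owner ruling ρ-g9-30 l.29421 «M10 IS IN THE TREE's CONE — COURIER ORDER»; consumers: `NeedleGhostBubbleRow.h₄_of_blockMass_scaling` ∕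
`h₅_…` (this lineage, NT-4∕NT-5: `hM` with `(CG, δG) := (cNear a, ghDelta a)`), leaf-04-g8's NT-7 v1.1 `hM0`, the re-issued «L-GBUB»).  For the printed
ancestry of the statement see beta-lit1-g32's LIT-ANSWER A-M10 l.29404 (B4 = Bałaban CMP 89 (1983) p. 573 (1.10)) — NOT used here: the tree proves it.

CONTENT.  `cNear`, `ghA0_pos`, `dist_eq_supNorm` (the sup metric on `ℤ⁴` is the sup norm of the difference), `abs_Ggh_le_of_ne` (`ghost_d0` read at
base point `t`, offset `y − t`), **`sum_B_abs_Ggh_le`** (FAR blocks `dist ≥ 2`: `n⁴` terms `≤ ghA0·e^{δ}e^{−δD}∕n⁴`; NEAR blocks: diagonal `2∕min 2 a` +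
`(ghA0∕n²)·Σ_{0<|z|_∞≤2n} |z|_∞⁻² ≤ 865·ghA0`).
Provenance: theorem and proof = an3 gen 57 (planner-b2b-balaban-beta-an3-g57-0) scratch VERBATIM (namespace renamed, docstrings added); courier = unit
`b2b-balaban-gan24-formalise-leaf-05` (gen 41) per ρ-g9-30; `LEAVES-BFx.md` row (N) ∕ letter M10.
-/

namespace Summit.QuantumFields.BalabanUV.Beta.D1BFx.GhostLegBlockMass

open Finset Real
open Literature.MathematicalPhysics.QuantumFieldTheory.Balaban1983to89
open Literature.MathematicalPhysics.QuantumFieldTheory.Balaban1983to89.Beta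
open B6QGQLower276 (X e blk B mem_B side side_facts side_mul_blk_add_loc loc loc_nonneg loc_le)
open B6QGQDecay237 (deltaU deltaU_pos deltaU_le_one dist_blk_ge card_B)
open B5Hk103ScalarZd (Gk)
open Beta.PoissonInterior (nrm one_le_nrm nrm_pos supNorm_le_nrm natAbs_le_supNorm exists_natAbs_eq_supNorm supNorm_eq_zero_iff
  cube mem_cube_zero_iff sum_cube_inv_nrm_pow_le)
open DyadicShell (Pt supNorm)
open Summit.QuantumFields.BalabanUV.Beta.D1BFx.GhostLeg (Ggh Ggh_apply cast_pred_add_one abs_Ggh_le)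
open Summit.QuantumFields.BalabanUV.Beta.D1BFx.PointColumnSplit (cG0 cG0_nonneg cSplit cSplit_nonneg)
open Summit.QuantumFields.BalabanUV.Beta.D1BFx.PointColumnDecay (cFar cFar_pos)
open Summit.QuantumFields.BalabanUV.Beta.D1BFx.GhostLegFree (ghA0 ghDelta ghDelta_pos ghost_d0 natAbs_sub_le_blk supNorm_eq nrm_eq_supNorm)

noncomputable section

/-- [our object] **The block-row mass constant of the scalar ghost leg** `cNear a := (2∕min 2 a + 865·ghA0 a)·e^{2·ghDelta a}` — n-FREE (an3-g57's body verbatim). -/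
def cNear (a : ℝ) : ℝ := (2 / min 2 a + 865 * ghA0 a) * Real.exp (2 * ghDelta a)

/-- [folklore] `GhostLegFree.ghA0 a > 0` for `a > 0`. -/
theorem ghA0_pos {a : ℝ} (ha : 0 < a) : 0 < ghA0 a := by
  unfold ghA0
  have h1 := cG0_nonneg 4
  have h2 := cSplit_nonneg 4 ha
  have h3 := cFar_pos 4 ha
  have h4 := deltaU_pos 4 ha
  positivity

/-- [folklore] the sup metric on `Fin 4 → ℤ` is the sup norm of the difference. -/
theorem dist_eq_supNorm (p q : Pt) : dist p q = (supNorm (p - q) : ℝ) := by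
  apply le_antisymm
  · refine (dist_pi_le_iff (by positivity)).2 fun i => ?_
    rw [Int.dist_eq]
    have h : (((p - q) i).natAbs : ℝ) ≤ (supNorm (p - q) : ℝ) := by
      rw [supNorm_eq]; exact_mod_cast natAbs_le_supNorm (p - q) i
    have e1 : (((p - q) i).natAbs : ℝ) = |((p i : ℝ) - (q i : ℝ))| := by
      rw [Nat.cast_natAbs, Int.cast_abs, Pi.sub_apply, Int.cast_sub]
    linarith [e1 ▸ h]
  · obtain ⟨i, hi⟩ := exists_natAbs_eq_supNorm (by norm_num : 0 < 4) (p - q)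
    have h := dist_le_pi_dist p q i
    rw [Int.dist_eq] at h
    have e1 : (((p - q) i).natAbs : ℝ) = |((p i : ℝ) - (q i : ℝ))| := by
      rw [Nat.cast_natAbs, Int.cast_abs, Pi.sub_apply, Int.cast_sub]
    rw [supNorm_eq, ← hi, e1]
    exact h

variable (n : ℕ) [NeZero n] {a : ℝ}

/-- [folklore] pointwise: for `t ≠ y`, `|Ggh n a y t| ≤ ghA0 a · e^{−(ghDelta a/n)·|y−t|_∞} / (n²·|y−t|_∞²)` (= `ghost_d0` at
base point `t`, offset `y − t`, divided by `n²`). -/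
theorem abs_Ggh_le_of_ne (ha : 0 < a) {y t : Pt} (hyt : y ≠ t) :
    |Ggh n a y t () ()| ≤ ghA0 a * Real.exp (-(ghDelta a / n) * supNorm (y - t)) / ((n : ℝ) ^ 2 * (supNorm (y - t) : ℝ) ^ 2) := by
  have hn : (0 : ℝ) < n := by exact_mod_cast Nat.pos_of_ne_zero (NeZero.ne n)
  have hv : y - t ≠ 0 := sub_ne_zero.2 hyt
  have h := ghost_d0 n ha t (y - t) hv
  rw [add_sub_cancel] at h
  rw [abs_mul, abs_of_pos (pow_pos hn 2)] at h
  rw [le_div_iff₀ (by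
    have : (0 : ℝ) < (supNorm (y - t) : ℝ) := by
      have : 0 < DyadicShell.supNorm (y - t) := DyadicShell.supNorm_pos hv
      exact_mod_cast this
    positivity)]
  have hN : (0 : ℝ) < (supNorm (y - t) : ℝ) := by
    have : 0 < DyadicShell.supNorm (y - t) := DyadicShell.supNorm_pos hv
    exact_mod_cast this
  rw [le_div_iff₀ (pow_pos hN 2)] at h
  calc |Ggh n a y t () ()| * ((n : ℝ) ^ 2 * (supNorm (y - t) : ℝ) ^ 2)
      = (n : ℝ) ^ 2 * |Ggh n a y t () ()| * (supNorm (y - t) : ℝ) ^ 2 := by ring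
    _ ≤ ghA0 a * Real.exp (-(ghDelta a / n) * supNorm (y - t)) := h

/-- [folklore] **M10 — THE BLOCK-ROW |·|-MASS OF THE SCALAR GHOST LEG, n-FREE** (corollary of the hypothesis-free `GhostLegFree.ghost_d0`, p214847):
`Σ_{t ∈ B (n−1) β} |Ggh n a y t| ≤ cNear a · e^{−ghDelta a · dist (blk (n−1) y) β}` for every `n ≥ 1`, `a > 0`, `y`, `β`. -/
theorem sum_B_abs_Ggh_le (ha : 0 < a) (y β : Pt) :
    ∑ t ∈ B (n - 1) β, |Ggh n a y t () ()| ≤ cNear a * Real.exp (-(ghDelta a * dist (blk (n - 1) y) β)) := by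
  have hn : (0 : ℝ) < n := by exact_mod_cast Nat.pos_of_ne_zero (NeZero.ne n)
  have hn1 : (1 : ℝ) ≤ n := by exact_mod_cast NeZero.one_le
  set m : ℕ := n - 1 with hm
  have hmn : ((m : ℝ) + 1) = n := cast_pred_add_one n
  set δ := ghDelta a with hδ
  have hδ0 : 0 < δ := ghDelta_pos ha
  have hA0 : 0 < ghA0 a := ghA0_pos ha
  set D : ℝ := dist (blk m y) β with hD
  have hD0 : 0 ≤ D := dist_nonneg
  have hy : y ∈ B m (blk m y) := mem_B.2 rfl
  -- the diagonal constant
  have hdiag : ∀ t : Pt, |Ggh n a y t () ()| ≤ 2 / min 2 a := by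
    intro t
    have h := abs_Ggh_le n a ha y t () ()
    refine h.trans ?_
    have hmin : 0 < 2 / min 2 a := div_pos two_pos (lt_min two_pos ha)
    have : Real.exp (-(deltaU 4 a * (dist y t / (n : ℝ)))) ≤ 1 := by
      rw [Real.exp_le_one_iff]
      have := deltaU_pos 4 ha
      have : 0 ≤ dist y t / (n : ℝ) := div_nonneg dist_nonneg hn.le
      nlinarith
    calc 2 / min 2 a * Real.exp (-(deltaU 4 a * (dist y t / (n : ℝ)))) ≤ 2 / min 2 a * 1 :=
          mul_le_mul_of_nonneg_left this hmin.le
      _ = 2 / min 2 a := mul_one _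
  have hmin0 : 0 < 2 / min 2 a := div_pos two_pos (lt_min two_pos ha)
  -- lower bound on the site distance from the block distance
  have hlow : ∀ t ∈ B m β, (n : ℝ) * D - m ≤ (supNorm (y - t) : ℝ) := by
    intro t ht
    have h := dist_blk_ge hy ht
    rw [hmn] at h
    rw [dist_eq_supNorm y t] at h
    exact h
  have hmle : (m : ℝ) ≤ n - 1 := by linarith
  by_cases hfar : 2 ≤ D
  · -- FAR blocks: every term ≤ ghA0·e^{δ}·e^{−δD}/n⁴, and there are n⁴ terms
    have hterm : ∀ t ∈ B m β, |Ggh n a y t () ()| ≤ ghA0 a * Real.exp δ * Real.exp (-(δ * D)) / (n : ℝ) ^ 4 := by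
      intro t ht
      have hN := hlow t ht
      have hNn : (n : ℝ) + 1 ≤ (supNorm (y - t) : ℝ) := by nlinarith
      have hyt : y ≠ t := by
        intro h
        rw [h, sub_self] at hNn
        have : (supNorm (0 : Pt) : ℝ) = 0 := by
          rw [supNorm_eq]; exact_mod_cast (supNorm_eq_zero_iff.2 rfl)
        linarith
      have h1 := abs_Ggh_le_of_ne n ha hyt
      refine h1.trans ?_
      have hNpos : (0 : ℝ) < (supNorm (y - t) : ℝ) := by linarith
      rw [div_le_div_iff₀ (by positivity) (by positivity)]
      -- exponential factor
      have hexp : Real.exp (-(ghDelta a / n) * supNorm (y - t)) ≤ Real.exp δ * Real.exp (-(δ * D)) := by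
        rw [← Real.exp_add]
        apply Real.exp_le_exp.2
        rw [← hδ]
        have : δ / n * ((n : ℝ) * D - m) ≤ δ / n * (supNorm (y - t) : ℝ) :=
          mul_le_mul_of_nonneg_left hN (div_nonneg hδ0.le hn.le)
        have e2 : δ / n * ((n : ℝ) * D - m) = δ * D - δ * (m / n) := by field_simp
        have e3 : δ * ((m : ℝ) / n) ≤ δ := by
          have : (m : ℝ) / n ≤ 1 := by rw [div_le_one hn]; linarith
          nlinarith
        nlinarith
      -- polynomial factor: n⁴ ≤ n²·N²
      have hpoly : (n : ℝ) ^ 4 ≤ (n : ℝ) ^ 2 * (supNorm (y - t) : ℝ) ^ 2 := by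
        have : (n : ℝ) ≤ (supNorm (y - t) : ℝ) := by linarith
        have h2 : (n : ℝ) ^ 2 ≤ (supNorm (y - t) : ℝ) ^ 2 := pow_le_pow_left₀ hn.le this 2
        nlinarith [pow_pos hn 2]
      calc ghA0 a * Real.exp (-(ghDelta a / n) * supNorm (y - t)) * (n : ℝ) ^ 4
          ≤ ghA0 a * (Real.exp δ * Real.exp (-(δ * D))) * ((n : ℝ) ^ 2 * (supNorm (y - t) : ℝ) ^ 2) := by
            apply mul_le_mul (mul_le_mul_of_nonneg_left hexp hA0.le) hpoly (by positivity) (by positivity)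
        _ = ghA0 a * Real.exp δ * Real.exp (-(δ * D)) * ((n : ℝ) ^ 2 * (supNorm (y - t) : ℝ) ^ 2) := by ring
    calc ∑ t ∈ B m β, |Ggh n a y t () ()|
        ≤ ∑ _t ∈ B m β, ghA0 a * Real.exp δ * Real.exp (-(δ * D)) / (n : ℝ) ^ 4 := Finset.sum_le_sum hterm
      _ = ((m : ℝ) + 1) ^ 4 * (ghA0 a * Real.exp δ * Real.exp (-(δ * D)) / (n : ℝ) ^ 4) := by
          rw [Finset.sum_const, nsmul_eq_mul, card_B]
      _ = ghA0 a * Real.exp δ * Real.exp (-(δ * D)) := by rw [hmn]; field_simp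
      _ ≤ cNear a * Real.exp (-(δ * D)) := by
          apply mul_le_mul_of_nonneg_right _ (Real.exp_pos _).le
          unfold cNear
          rw [← hδ]
          have h1 : Real.exp δ ≤ Real.exp (2 * δ) := Real.exp_le_exp.2 (by linarith)
          have h2 : ghA0 a ≤ 2 / min 2 a + 865 * ghA0 a := by linarith
          calc ghA0 a * Real.exp δ ≤ (2 / min 2 a + 865 * ghA0 a) * Real.exp (2 * δ) :=
                mul_le_mul h2 h1 (Real.exp_pos _).le (by positivity)
            _ = _ := rfl
  · -- NEAR blocks (D ≤ 1): the diagonal term + ghA0/n² · Σ_{0 < |z|_∞ ≤ 2n} |z|_∞^{-2} ≤ 2/min 2 a + 865·ghA0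
    push Not at hfar
    have hDi : ∀ i : Fin 4, ((blk m y i - β i).natAbs : ℝ) ≤ 1 := by
      intro i
      have h := dist_le_pi_dist (blk m y) β i
      rw [Int.dist_eq] at h
      have e1 : (((blk m y i - β i).natAbs : ℝ)) = |((blk m y i : ℝ) - (β i : ℝ))| := by
        rw [Nat.cast_natAbs, Int.cast_abs, Int.cast_sub]
      have h2 : ((blk m y i - β i).natAbs : ℝ) < 2 := by rw [e1]; linarith
      have h3 : (blk m y i - β i).natAbs < 2 := by exact_mod_cast h2
      have h4 : (blk m y i - β i).natAbs ≤ 1 := by omega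
      exact_mod_cast h4
    -- every site of the block is within sup distance 2n of y
    have hcube : ∀ t ∈ B m β, y - t ∈ cube (0 : Pt) (2 * n) := by
      intro t ht
      rw [mem_cube_zero_iff, Beta.PoissonInterior.supNorm, Finset.sup_le_iff]
      intro i _
      have h := natAbs_sub_le_blk m y t i
      rw [mem_B.1 ht, hmn] at h
      have h2 := hDi i
      have h3 : (((y - t) i).natAbs : ℝ) ≤ (n : ℝ) * 1 + m := by nlinarith
      have h4 : (((y - t) i).natAbs : ℝ) ≤ 2 * n := by linarith
      exact_mod_cast h4
    -- split off the diagonal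
    have hsplit : ∑ t ∈ B m β, |Ggh n a y t () ()| ≤
        2 / min 2 a + ∑ t ∈ (B m β).erase y, |Ggh n a y t () ()| := by
      by_cases hyB : y ∈ B m β
      · rw [← Finset.add_sum_erase _ _ hyB]
        linarith [hdiag y]
      · rw [Finset.erase_eq_self.2 hyB]
        linarith [hmin0.le]
    -- the off-diagonal terms against the cube sum
    have hoff : ∀ t ∈ (B m β).erase y, |Ggh n a y t () ()| ≤ ghA0 a / (n : ℝ) ^ 2 * (1 / nrm (y - t) ^ 2) := by
      intro t ht
      rw [Finset.mem_erase] at ht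
      have hyt : y ≠ t := fun h => ht.1 h.symm
      have h1 := abs_Ggh_le_of_ne n ha hyt
      refine h1.trans ?_
      have hv : y - t ≠ 0 := sub_ne_zero.2 hyt
      have hnrm : nrm (y - t) = (supNorm (y - t) : ℝ) := nrm_eq_supNorm hv
      have hNpos : (0 : ℝ) < (supNorm (y - t) : ℝ) := by
        have : 0 < DyadicShell.supNorm (y - t) := DyadicShell.supNorm_pos hv
        exact_mod_cast this
      have hexp : Real.exp (-(ghDelta a / n) * supNorm (y - t)) ≤ 1 := by
        rw [Real.exp_le_one_iff]
        have : 0 ≤ ghDelta a / n * (supNorm (y - t) : ℝ) := by positivity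
        linarith
      rw [hnrm]
      rw [div_le_iff₀ (by positivity)]
      calc ghA0 a * Real.exp (-(ghDelta a / n) * supNorm (y - t)) ≤ ghA0 a * 1 :=
            mul_le_mul_of_nonneg_left hexp hA0.le
        _ = ghA0 a / (n : ℝ) ^ 2 * (1 / (supNorm (y - t) : ℝ) ^ 2) * ((n : ℝ) ^ 2 * (supNorm (y - t) : ℝ) ^ 2) := by
            field_simp
    have hsumcube : ∑ t ∈ (B m β).erase y, (1 / nrm (y - t) ^ 2) ≤ ∑ z ∈ cube (0 : Pt) (2 * n), 1 / nrm z ^ 2 := by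
      rw [← Finset.sum_image (f := fun z : Pt => 1 / nrm z ^ 2) (s := (B m β).erase y) (g := fun t => y - t)
        (fun t₁ _ t₂ _ h => by simpa using h)]
      apply Finset.sum_le_sum_of_subset_of_nonneg
      · intro z hz
        rw [Finset.mem_image] at hz
        obtain ⟨t, ht, rfl⟩ := hz
        exact hcube t (Finset.mem_of_mem_erase ht)
      · intro z _ _
        have := nrm_pos z
        positivity
    have hcubeval : ∑ z ∈ cube (0 : Pt) (2 * n), 1 / nrm z ^ 2 ≤ 1 + 864 * (n : ℝ) ^ 2 := by
      have h := sum_cube_inv_nrm_pow_le (d := 4) (by norm_num) (2 * n) 2 (by norm_num)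
      refine h.trans (le_of_eq ?_)
      push_cast
      norm_num
      ring
    have hoffsum : ∑ t ∈ (B m β).erase y, |Ggh n a y t () ()| ≤ 865 * ghA0 a := by
      calc ∑ t ∈ (B m β).erase y, |Ggh n a y t () ()|
          ≤ ∑ t ∈ (B m β).erase y, ghA0 a / (n : ℝ) ^ 2 * (1 / nrm (y - t) ^ 2) := Finset.sum_le_sum hoff
        _ = ghA0 a / (n : ℝ) ^ 2 * ∑ t ∈ (B m β).erase y, (1 / nrm (y - t) ^ 2) := by rw [Finset.mul_sum]
        _ ≤ ghA0 a / (n : ℝ) ^ 2 * (1 + 864 * (n : ℝ) ^ 2) :=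
            mul_le_mul_of_nonneg_left (hsumcube.trans hcubeval) (by positivity)
        _ = ghA0 a * (1 / (n : ℝ) ^ 2 + 864) := by field_simp
        _ ≤ ghA0 a * (1 + 864) := by
            apply mul_le_mul_of_nonneg_left _ hA0.le
            have : 1 / (n : ℝ) ^ 2 ≤ 1 := by
              rw [div_le_one (pow_pos hn 2)]
              nlinarith
            linarith
        _ = 865 * ghA0 a := by ring
    have htot : ∑ t ∈ B m β, |Ggh n a y t () ()| ≤ 2 / min 2 a + 865 * ghA0 a := by linarith
    refine htot.trans ?_
    unfold cNear
    rw [← hδ, mul_assoc, ← Real.exp_add]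
    have hexp1 : 1 ≤ Real.exp (2 * δ + -(δ * D)) := by
      rw [Real.one_le_exp_iff]; nlinarith
    have hpos : 0 ≤ 2 / min 2 a + 865 * ghA0 a := by positivity
    nlinarith

end

end Summit.QuantumFields.BalabanUV.Beta.D1BFx.GhostLegBlockMass
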